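import Summits.CriticalPhenomena.CardyFormulaZ2.Theses.CardyQContinuation
import Literature.Probability.LatticeModels.RandomCluster
import Literature.Probability.LatticeModels.RandomClusterEmbedding

/-!
# Wiring isolated vertices does not change the random-cluster measure
(route CardyQContinuation, serves stmt-CriticalPhenomena-5560, registered stub
`stub_loopSymmetricLimit_rcMeasure_wired_isolated` of the n = 0 bridge of the crux
`IsingJetsConformal`)

Plumbing for the n = 0 sandwich of the crux: when the discretisation `Ω_δ` and a designed
quadrilateral are placed on a common finite vertex type, the embedding lemma
`rcMeasure_real_map_of_wired` (`RandomClusterEmbedding.lean`) forces the idle vertices into the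
wired set while `rcMeasure_real_map_image` leaves them out. The two are reconciled by the present
file: for a finite graph `G`, parameters `0 < q` (and any `p`), a wired set `B` and a set `I` of
**isolated** vertices of `G` (no `G`-neighbours), the random-cluster measures with wired sets
`B ∪ I` and `B` coincide, `φ^{B ∪ I}_{G,p,q} = φ^{B}_{G,p,q}` (`rcMeasure`, Grimmett 2006, (1.2)).

## Proof

For `ω ⊆ E(G)` write `K_ω = ⟨ω⟩ ∨ W_B ≤ L_ω = ⟨ω⟩ ∨ W_{B ∪ I}` for the two wired open graphs. The
cluster counts differ by a constant: `k(L_ω) + k(W_B) = k(K_ω) + k(W_{B ∪ I})`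
(`RcMeasureWiredIsolated.card_connectedComponent_add_eq`), by induction on `ω`, opening one edge
`xy ∈ E(G)` at a time: the endpoints `x, y` are not in `I`, and two vertices off `I` are joined in
`L_ω` iff they are joined in `K_ω` (`reachable_wired_union_iff`: along an `L_ω`-walk, an excursion
through `I` enters and leaves through the wiring, i.e. through `B`, and `B` is one block of `K_ω`),
so opening `xy` lowers both counts by the same amount (`card_connectedComponent_sup_edge_add_eq`,
from the one-edge identities of `RandomClusterFKG.lean`). Hence the weights, and the partition
functions, with wired sets `B ∪ I` and `B` differ by the same constant power of `q`, which cancels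
in the normalised masses of `rcMeasure`. No case distinction on `B = ∅` is needed. Everything is
proved; no new definitions. [folklore]

References: G. Grimmett, *The Random-Cluster Model*, Springer 2006, §1.2 eq. (1.2), §4.2.
-/

namespace Summit.CriticalPhenomena.CardyFormulaZ2.Theorems.CardyQContinuation

open Literature.Probability.LatticeModels Literature.Probability SimpleGraph Finset MeasureTheory

namespace RcMeasureWiredIsolated

variable {V : Type*}

/-! ### Reachability off the isolated set -/

/-- **Walks through newly wired isolated vertices can be rerouted through `B`.** Let `a` be a
configuration none of whose edges touches `I`, and `K = ⟨a⟩ ∨ W_B ≤ L = ⟨a⟩ ∨ W_{B ∪ I}`. For an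
`L`-walk from `x` to a vertex `y ∉ I`: if `x ∉ I` then `x` and `y` are joined in `K`; if `x ∈ I`
then every vertex of `B` is joined to `y` in `K`. [folklore] -/
theorem reachable_of_reachable_wired_union {a : Set (Sym2 V)} {B I : Set V}
    (ha : ∀ v w, (Percolation.openGraph a).Adj v w → v ∉ I) {x y : V} (hy : y ∉ I)
    (h : (Percolation.openGraph a ⊔ wired (B ∪ I)).Reachable x y) :
    (x ∉ I → (Percolation.openGraph a ⊔ wired B).Reachable x y) ∧
      (x ∈ I → ∀ b ∈ B, (Percolation.openGraph a ⊔ wired B).Reachable b y) := by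
  obtain ⟨p⟩ := h
  induction p with
  | nil => exact ⟨fun _ => Reachable.refl _, fun hx => absurd hx hy⟩
  | @cons u v w hadj p ih =>
    have ih := ih hy
    rw [sup_adj, wired_adj, Set.mem_union, Set.mem_union] at hadj
    refine ⟨fun hu => ?_, fun hu b hb => ?_⟩
    · rcases hadj with h | ⟨hne, huBI, hvBI⟩
      · have hv : v ∉ I := ha v u h.symm
        have hK : (Percolation.openGraph a ⊔ wired B).Adj u v := (sup_adj _ _ _ _).2 (Or.inl h)
        exact hK.reachable.trans (ih.1 hv)
      · have huB : u ∈ B := huBI.resolve_right hu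
        by_cases hv : v ∈ I
        · exact ih.2 hv u huB
        · have hvB : v ∈ B := hvBI.resolve_right hv
          have hK : (Percolation.openGraph a ⊔ wired B).Adj u v := by
            rw [sup_adj, wired_adj]
            exact Or.inr ⟨hne, huB, hvB⟩
          exact hK.reachable.trans (ih.1 hv)
    · rcases hadj with h | ⟨-, -, hvBI⟩
      · exact absurd hu (ha u v h)
      · by_cases hv : v ∈ I
        · exact ih.2 hv b hb
        · have hvB : v ∈ B := hvBI.resolve_right hv
          have hbv : (Percolation.openGraph a ⊔ wired B).Reachable b v := by
            by_cases hbv : b = v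
            · exact hbv ▸ Reachable.refl _
            · refine Adj.reachable ?_
              rw [sup_adj, wired_adj]
              exact Or.inr ⟨hbv, hb, hvB⟩
          exact hbv.trans (ih.1 hv)

/-- Enlarging the wired set enlarges the wiring graph. [folklore] -/
theorem wired_le_wired_union (B I : Set V) : wired B ≤ wired (B ∪ I) := by
  intro v w h
  rw [wired_adj] at h ⊢
  exact ⟨h.1, Or.inl h.2.1, Or.inl h.2.2⟩

/-- **Two vertices off `I` are joined with `B ∪ I` wired iff they are joined with `B` wired**, for a
configuration none of whose edges touches `I`. [folklore] -/
theorem reachable_wired_union_iff {a : Set (Sym2 V)} (B : Set V) {I : Set V}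
    (ha : ∀ v w, (Percolation.openGraph a).Adj v w → v ∉ I) {x y : V} (hx : x ∉ I) (hy : y ∉ I) :
    (Percolation.openGraph a ⊔ wired B).Reachable x y ↔
      (Percolation.openGraph a ⊔ wired (B ∪ I)).Reachable x y :=
  ⟨fun h => h.mono (sup_le_sup_left (wired_le_wired_union B I) _),
    fun h => (reachable_of_reachable_wired_union ha hy h).1 hx⟩

/-! ### The constant shift of the cluster count -/

/-- Adding an edge changes the number of components of two graphs in the same way as soon as its
endpoints are joined in both or in neither (local copy of the lemma of
`RandomClusterPinnedComparison.lean`, to keep the imports light). [folklore] -/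
theorem card_connectedComponent_sup_edge_add_eq [Finite V] {K L : SimpleGraph V} {u v : V}
    (h : K.Reachable u v ↔ L.Reachable u v) :
    Nat.card (K ⊔ edge u v).ConnectedComponent + Nat.card L.ConnectedComponent =
      Nat.card K.ConnectedComponent + Nat.card (L ⊔ edge u v).ConnectedComponent := by
  by_cases huv : K.Reachable u v
  · rw [card_connectedComponent_sup_edge_of_reachable K huv,
      card_connectedComponent_sup_edge_of_reachable L (h.1 huv), add_comm]
  · have hL : ¬ L.Reachable u v := fun h' => huv (h.2 h')
    have h1 := card_connectedComponent_sup_edge_lt K huv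
    have h2 := card_connectedComponent_le_sup_edge_add_one K u v
    have h3 := card_connectedComponent_sup_edge_lt L hL
    have h4 := card_connectedComponent_le_sup_edge_add_one L u v
    omega

/-- The open graph of `insert xy ω` is the open graph of `ω` plus the edge `xy` (local copy of
`FKInterfacePairing.openGraph_coe_insert`). [folklore] -/
theorem openGraph_coe_insert [DecidableEq V] (ω : Finset (Sym2 V)) (x y : V) :
    Percolation.openGraph (↑(insert s(x, y) ω) : Percolation.BondConfig V) =
      Percolation.openGraph (↑ω : Percolation.BondConfig V) ⊔ edge x y := by
  ext u v
  simp only [Percolation.openGraph_adj, Finset.coe_insert, Set.mem_insert_iff, Finset.mem_coe,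
    sup_adj, edge_adj, Sym2.eq_iff]
  tauto

variable [Fintype V] [DecidableEq V] (G : SimpleGraph V) [DecidableRel G.Adj] {I : Set V}

omit [DecidableEq V] in
/-- No edge of a subconfiguration of `E(G)` touches a set of isolated vertices of `G`. [folklore] -/
theorem not_mem_of_openGraph_adj (hI : ∀ x ∈ I, ∀ y : V, ¬ G.Adj x y) {a : Finset (Sym2 V)}
    (ha : a ⊆ G.edgeFinset) (v w : V)
    (h : (Percolation.openGraph (↑a : Percolation.BondConfig V)).Adj v w) : v ∉ I := by
  rw [Percolation.openGraph_adj, Finset.mem_coe] at h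
  have hG : G.Adj v w := by
    have := ha h.1
    rwa [mem_edgeFinset, mem_edgeSet] at this
  exact fun hv => hI v hv w hG

/-- **Wiring isolated vertices shifts the cluster count by a constant.** For `ω ⊆ E(G)` and a set
`I` of isolated vertices of `G`,
`k(⟨ω⟩ ∨ W_{B ∪ I}) + k(W_B) = k(⟨ω⟩ ∨ W_B) + k(W_{B ∪ I})`. [folklore] -/
theorem card_connectedComponent_add_eq (hI : ∀ x ∈ I, ∀ y : V, ¬ G.Adj x y) (B : Set V) :
    ∀ a : Finset (Sym2 V), a ⊆ G.edgeFinset →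
      Nat.card (Percolation.openGraph (↑a : Percolation.BondConfig V) ⊔
            wired (B ∪ I)).ConnectedComponent +
          Nat.card (wired B).ConnectedComponent =
        Nat.card (Percolation.openGraph (↑a : Percolation.BondConfig V) ⊔
            wired B).ConnectedComponent +
          Nat.card (wired (B ∪ I)).ConnectedComponent := by
  intro a
  induction a using Finset.induction_on with
  | empty =>
    intro _
    have h0 : Percolation.openGraph (↑(∅ : Finset (Sym2 V)) : Percolation.BondConfig V) = ⊥ := by
      rw [Finset.coe_empty, Percolation.openGraph, fromEdgeSet_empty]
    rw [h0, bot_sup_eq, bot_sup_eq, add_comm]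
  | @insert e a hea ih =>
    intro hsub
    have ha : a ⊆ G.edgeFinset := (Finset.subset_insert e a).trans hsub
    have he : e ∈ G.edgeFinset := hsub (Finset.mem_insert_self e a)
    have ih := ih ha
    have ha' := not_mem_of_openGraph_adj G hI ha
    induction e using Sym2.ind with
    | h x y =>
      rw [mem_edgeFinset, mem_edgeSet] at he
      have hx : x ∉ I := fun hx => hI x hx y he
      have hy : y ∉ I := fun hy => hI y hy x he.symm
      rw [openGraph_coe_insert, sup_right_comm _ (edge x y) (wired (B ∪ I)),
        sup_right_comm _ (edge x y) (wired B)]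
      have key := card_connectedComponent_sup_edge_add_eq
        (K := Percolation.openGraph (↑a : Percolation.BondConfig V) ⊔ wired B)
        (L := Percolation.openGraph (↑a : Percolation.BondConfig V) ⊔ wired (B ∪ I))
        (reachable_wired_union_iff B ha' hx hy)
      omega

/-! ### Weights, partition functions, measures -/

/-- The weights with wired sets `B ∪ I` and `B` differ by a constant power of `q`.
[folklore] -/
theorem pow_mul_rcWeight_union_eq (hI : ∀ x ∈ I, ∀ y : V, ¬ G.Adj x y) (p q : ℝ) (B : Set V)
    {a : Finset (Sym2 V)} (ha : a ⊆ G.edgeFinset) :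
    q ^ Nat.card (wired B).ConnectedComponent * rcWeight G p q (B ∪ I) a =
      q ^ Nat.card (wired (B ∪ I)).ConnectedComponent * rcWeight G p q B a := by
  have h := card_connectedComponent_add_eq G hI B a ha
  unfold rcWeight clusterCount
  conv_lhs => rw [mul_comm, mul_assoc, ← pow_add, h, pow_add]
  ring

/-- The partition functions with wired sets `B ∪ I` and `B` differ by the same constant power of
`q`. [folklore] -/
theorem pow_mul_rcPartitionFunction_union_eq (hI : ∀ x ∈ I, ∀ y : V, ¬ G.Adj x y) (p q : ℝ)
    (B : Set V) :
    q ^ Nat.card (wired B).ConnectedComponent * rcPartitionFunction G p q (B ∪ I) =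
      q ^ Nat.card (wired (B ∪ I)).ConnectedComponent * rcPartitionFunction G p q B := by
  unfold rcPartitionFunction
  rw [Finset.mul_sum, Finset.mul_sum]
  exact Finset.sum_congr rfl fun a ha =>
    pow_mul_rcWeight_union_eq G hI p q B (Finset.mem_powerset.1 ha)

/-- **Wiring isolated vertices does not change the random-cluster measure**:
`φ^{B ∪ I}_{G,p,q} = φ^{B}_{G,p,q}` for `0 < q` and `I` a set of isolated vertices of `G`
(Grimmett 2006, (1.2): the constant factor of the weights cancels upon normalisation).
[folklore] -/
theorem rcMeasure_union_eq_of_isolated (hI : ∀ x ∈ I, ∀ y : V, ¬ G.Adj x y) (p : ℝ) {q : ℝ}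
    (hq : 0 < q) (B : Set V) : rcMeasure G p q (B ∪ I) = rcMeasure G p q B := by
  unfold rcMeasure
  refine Finset.sum_congr rfl fun a ha => ?_
  have hc₁ : q ^ Nat.card (wired B).ConnectedComponent ≠ 0 := pow_ne_zero _ hq.ne'
  have hc₂ : q ^ Nat.card (wired (B ∪ I)).ConnectedComponent ≠ 0 := pow_ne_zero _ hq.ne'
  rw [← mul_div_mul_left (rcWeight G p q (B ∪ I) a) (rcPartitionFunction G p q (B ∪ I)) hc₁,
    pow_mul_rcWeight_union_eq G hI p q B (Finset.mem_powerset.1 ha),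
    pow_mul_rcPartitionFunction_union_eq G hI p q B, mul_div_mul_left _ _ hc₂]

end RcMeasureWiredIsolated

open RcMeasureWiredIsolated in
/-- **Registered stub `stub_loopSymmetricLimit_rcMeasure_wired_isolated`** of the n = 0 bridge of
the crux `IsingJetsConformal` (stmt-CriticalPhenomena-5560): adding to the wired set `B` a set `I`
of isolated vertices of the finite graph `G` does not change the random-cluster measure
`φ^B_{G,p,q}` (`0 ≤ p ≤ 1`, `0 < q`; the hypothesis on `p` is not used). [folklore] -/
theorem stub_loopSymmetricLimit_rcMeasure_wired_isolated : (∀ (V : Type) [Fintype V] [DecidableEq V] (G : SimpleGraph V) [DecidableRel G.Adj] (p q : ℝ), p ∈ Set.Icc (0 : ℝ) 1 → 0 < q → ∀ (B I : Set V), (∀ x ∈ I, ∀ y : V, ¬ G.Adj x y) → Literature.Probability.LatticeModels.rcMeasure G p q (B ∪ I) = Literature.Probability.LatticeModels.rcMeasure G p q B) := by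
  intro V _ _ G _ p q _ hq B I hI
  exact rcMeasure_union_eq_of_isolated G hI p hq B

end Summit.CriticalPhenomena.CardyFormulaZ2.Theorems.CardyQContinuation
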